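import Literature.NumberTheory.EllipticCurves.SelmerInftyTorsionFiniteProofs
import Literature.NumberTheory.EllipticCurves.SelmerLevelToPrimary
import HarnessLib

/-!
# Kummer lift at level `p^k` over any subgroup: `H¹(H, E[p^k]) ↠ H¹(H, E[p^∞])[p^k]`
# (crux ♭T′ stmt-BirchSwinnertonDyer-26975, line `sigmacongruence`, brick (1c-γ) of the growth road to stub TS1)

Route `UniversalToricDescent`, lead prover `bsd-wall-utd-p1` g15. THEOREMS ONLY; `--supports stmt-BirchSwinnertonDyer-26975`.
BSD is not proved by any of this.

The tree has the level-`p` lift over a subgroup (`WeierstrassCurve.exists_torsionToPrimaryH1Sub_eq`, SelmerInftyTorsionFiniteProofs)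
and the level-`p^M` map over `Γ_K` (`torsionPowToPrimaryH1`, SelmerLevelToPrimary). The local upper growth at the strict place
(memo GROWTH-ROAD-utdp1g15 §5 (1c)) needs the level-`p^k` lift over the LOCAL subgroups `ker κ ⊓ D_𝔭′` of `Γ_K`:
* `exists_pow_nsmul_eq_geomPrimaryTorsion` — `E[p^∞]` is `p^k`-divisible (from the divisibility of `E(K̄)`);
* `exists_resH1Hom_torsionPow_eq` — every class `x ∈ H¹(H, E[p^∞])` with `p^k x = 0` is the image of a class of `H¹(H, E[p^k])`
  under the map induced by `E[p^k] ↪ E[p^∞]` (verbatim the level-`p` cocycle argument: `p^k φ = ∂a`, `a = p^k b`, `φ − ∂b` is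
  `E[p^k]`-valued).
With `natCard_torsion_fixed_le` (Theorems/…InvariantTorsionBound) this bounds `#H¹(H, E[p^∞])^{γ}[p^k]` by
`#ker · #H¹(H, E[p^k])^{γ}`.

References: [GreenbergLNM1716] §2 (p. 62), §5 p. 114; [GreenbergVatsal2000] §2 p. 25.
-/

set_option autoImplicit false
-- the Theorems namespace of this sub repeats the summit name by design (D-0017 nested layout)
set_option linter.dupNamespace false

noncomputable section

open scoped Classical
open Literature.NumberTheory.EllipticCurves Literature.NumberTheory.GaloisRepresentations Field

universe u

namespace Summit.BirchSwinnertonDyer.BirchSwinnertonDyer.Theorems.UniversalToricDescentKummerLiftPow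

variable {K : Type u} [Field K] (W : WeierstrassCurve K) (p : ℕ) [hp : Fact p.Prime]

/-- `E[p^∞]` is `p^k`-divisible, granted the divisibility of `E(K̄)` (`zsmul_geomPoints_surjective`, a theorem of the tree in
characteristic `0`). [cite: GreenbergLNM1716, §2 (p. 62)] -/
theorem exists_pow_nsmul_eq_geomPrimaryTorsion (hdiv : W.zsmul_geomPoints_surjective) [W.IsElliptic] (k : ℕ)
    (a : W.geomPrimaryTorsion p) : ∃ b : W.geomPrimaryTorsion p, (p ^ k : ℕ) • b = a := by
  induction k generalizing a with
  | zero => exact ⟨a, by rw [pow_zero, one_smul]⟩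
  | succ k ih =>
    obtain ⟨b, hb⟩ := ih a
    obtain ⟨c, hc⟩ := W.exists_nsmul_eq_geomPrimaryTorsion p hdiv b
    exact ⟨c, by rw [pow_succ, mul_smul, hc, hb]⟩

/-- **Kummer lift at level `p^k` over a subgroup `H ≤ Γ_K`: `H¹(H, E[p^k]) ↠ H¹(H, E[p^∞])[p^k]`.** If `p^k [φ] = 0` then
`p^k φ = ∂a` with `a = p^k b`, and `φ − ∂b` takes values in `E[p^k]`. [cite: GreenbergLNM1716, §5 p. 114] -/
theorem exists_resH1Hom_torsionPow_eq (hdiv : W.zsmul_geomPoints_surjective) [W.IsElliptic]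
    (H : Subgroup (absoluteGaloisGroup K)) (k : ℕ) {x : W.subgroupH1 p H} (hx : (p ^ k : ℕ) • x = 0) :
    ∃ y : Literature.NumberTheory.EllipticCurves.subgroupH1 H (WeierstrassCurve.geomTorsion W ((p ^ k : ℕ) : ℤ)),
      resH1Hom (ContinuousMonoidHom.id H)
        (AddSubgroup.inclusion (Literature.Barriers.BirchSwinnertonDyer.geomTorsion_pow_le_geomPrimaryTorsion W p k))
        (fun _ _ ↦ rfl) y = x := by
  obtain ⟨φ, rfl⟩ := oneCocycleClass_surjective _ x
  have h := oneCocycleClass_smul (discreteTopRep H (W.geomPrimaryTorsion p)) ((p ^ k : ℕ) : ℤ) φ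
  conv at h => rhs; rw [Nat.cast_smul_eq_nsmul, hx]
  obtain ⟨a, ha⟩ := (oneCocycleClass_eq_zero_iff _ _).mp h
  have ha' : ∀ σ : H, (p ^ k : ℕ) • φ.1 σ = σ • a - a := fun σ ↦ by
    rw [← natCast_zsmul]
    exact ha σ
  obtain ⟨b, rfl⟩ := exists_pow_nsmul_eq_geomPrimaryTorsion W p hdiv k a
  set φ' := φ - cobCocycle b (W.continuous_smul_geomPrimaryTorsion_sub p b) with hφ'
  have hval : ∀ σ : H, (p ^ k : ℕ) • φ'.1 σ = 0 := fun σ ↦ by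
    change (p ^ k : ℕ) • (φ.1 σ - (σ • b - b)) = 0
    rw [smul_sub, ha', smul_sub, smul_comm, sub_self]
  have hmem : ∀ σ : H,
      ((φ'.1 σ : W.geomPrimaryTorsion p) : WeierstrassCurve.geomPoints W) ∈
        WeierstrassCurve.geomTorsion W ((p ^ k : ℕ) : ℤ) := fun σ ↦
    AddSubgroup.torsionBy.nsmul_iff.mpr (by
      rw [← AddSubgroupClass.coe_nsmul, hval σ, ZeroMemClass.coe_zero])
  let χ : contOneCocycles (discreteTopRep H (WeierstrassCurve.geomTorsion W ((p ^ k : ℕ) : ℤ))) :=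
    contOneCocycles.lift
      (AddSubgroup.inclusion (Literature.Barriers.BirchSwinnertonDyer.geomTorsion_pow_le_geomPrimaryTorsion W p k))
      (fun _ _ ↦ rfl) (AddSubgroup.inclusion_injective _) φ' (fun σ ↦ ⟨_, hmem σ⟩)
      (fun _ ↦ rfl)
  refine ⟨oneCocycleClass _ χ, ?_⟩
  rw [resH1Hom_id_oneCocycleClass, contOneCocycles.push_lift, hφ', oneCocycleClass_sub,
    oneCocycleClass_cobCocycle, sub_zero]

end Summit.BirchSwinnertonDyer.BirchSwinnertonDyer.Theorems.UniversalToricDescentKummerLiftPow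

end
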